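import Summits.HodgeConjecture.HodgeConjecture.Theses.NikulinTwinTransport

/-!
# Route NikulinTwinTransport · crux `HodgeSimilitudeAlgebraic` (stmt-HodgeConjecture-13676) —
# line `kummer-bkr-quaternion-carrier`, stub `stub_kummerCode` (the Kummer code similitude)

Stub 1 of the line's skeleton: for every prime `q` there is an integral `q`-similitude `Mc` of `ℤ¹⁶`
(`Mcᵀ Mc = q·1`) whose reduction mod 2 maps affine functions on `𝔽₂⁴` — `Fin 16` read in binary via
`Bit[k, a]`, i.e. the Reed–Muller code `RM(1,4)`, the glue code of the Kummer overlattice (Nikulin) — to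
affine functions. This is the datum `CodeMatrix[q, Mc]` consumed by `stub_kummerSimilitude` /
`stub_kummerAnchor` of the same line.

## Mathematics

Write `q = a² + b² + c² + d²` (Lagrange, `Nat.sum_four_squares`; primality is not needed). Let
`L = LQ[a, b, c, d]` be LEFT multiplication by the Lipschitz quaternion `x = a + bi + cj + dk` on
`ℤ⁴ = ℤ⟨1, i, j, k⟩`; Euler's four-square identity is `Lᵀ L = (a²+b²+c²+d²)·1`. Put four copies of `L`
on the diagonal, on the index blocks `{4m, 4m+1, 4m+2, 4m+3}` (`m < 4`): `Mc (4m+r) (4m'+r') =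
[m = m'] L r r'`, realised as `Matrix.submatrix (Matrix.blockDiagonal fun _ => L) eB.symm eB.symm` for the
bijection `eB : Fin 4 × Fin 4 ≃ Fin 16`, `(r, m) ↦ 4m + r`. Then `Mcᵀ Mc = q·1` blockwise.

Code preservation holds for ALL integers `a, b, c, d`: if `y ≡ c₀ + Σ_k (c k) Bit_k (mod 2)` then
inside block `m` the residues are `y(4m) ≡ α`, `y(4m+1) ≡ α + c 0`, `y(4m+2) ≡ α + c 1`,
`y(4m+3) ≡ α + c 0 + c 1` (`α = c₀ + (c 2) Bit₂ + (c 3) Bit₃` depends only on `m`); every row of `L` is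
a signed permutation of `(a, b, c, d)` and signs die mod 2, so with `S = a + b + c + d` the vector `Mc y`
is again affine mod 2, with the explicit coefficients `c₀ ↦ S c₀ + (b + d) (c 0) + (c + d) (c 1)`,
`c k ↦ S (c k)`. The parity bookkeeping is the lemma `parity_block` (substitute `y_j = … + 2 z_j`,
normalise with `ring_nf`, close with `omega`: every monomial has an even coefficient).

Sources: folklore (Lipschitz/Hurwitz quaternions, Euler's identity; Nikulin's description of the Kummer
lattice glue as `RM(1,4)`). Pattern: `NikulinTwinTransportHodgeSimilitudeAlgebraicLattice` (explicit
integer matrices as local notations).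
-/

noncomputable section

open scoped Matrix

namespace Summit.HodgeConjecture.HodgeConjecture.Theorems.NikulinTwinTransport.KummerBkrQuaternionCarrier

/-! ## Local notations (the first three verbatim from the line's skeleton) -/

/-- `Bit[k, a] ∈ {0, 1} ⊂ ℤ`: the `k`-th binary digit of `a : Fin 16` — the identification
`Fin 16 = 𝔽₂⁴` under which the Reed–Muller code `RM(1,4)` is the space of affine functions (Nikulin's
description of the Kummer overlattice: `A[2]` as an affine `𝔽₂⁴`). Local notation only. -/
local notation3 (prettyPrint := false) "Bit[" k ", " a "]" =>
  (((Fin.val (a : Fin 16) / 2 ^ Fin.val (k : Fin 4)) % 2 : ℕ) : ℤ)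

/-- `AffineMod2[y]`: the integer vector `y : Fin 16 → ℤ` reduces mod 2 to a codeword of `RM(1,4)`,
i.e. to an affine function `a ↦ c₀ + Σ_k c_k·Bit[k,a]` on `𝔽₂⁴`. Local notation only. -/
local notation3 (prettyPrint := false) "AffineMod2[" y "]" =>
  (∃ (c₀ : ℤ) (c : Fin 4 → ℤ), ∀ a : Fin 16,
    (2 : ℤ) ∣ (y : Fin 16 → ℤ) a - c₀ - ∑ k : Fin 4, c k * Bit[k, a])

/-- `CodeMatrix[q, Mc]`: `Mc` is an integral `q`-similitude of `ℤ¹⁶` (`Mcᵀ Mc = q·1`) whose reduction mod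
2 preserves `RM(1,4)` — the card's `KummerCodeSimilitude` datum. Local notation only. -/
local notation3 (prettyPrint := false) "CodeMatrix[" q ", " Mc "]" =>
  (Matrix.transpose Mc * Mc = ((q : ℕ) : ℤ) • (1 : Matrix (Fin 16) (Fin 16) ℤ) ∧
    ∀ y : Fin 16 → ℤ, AffineMod2[y] → AffineMod2[Matrix.mulVec Mc y])

/-- `LQ[a, b, c, d]`: left multiplication by the Lipschitz quaternion `a + bi + cj + dk` on
`ℤ⁴ = ℤ⟨1, i, j, k⟩` (columns `x·1, x·i, x·j, x·k`). Local notation only. -/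
local notation3 (prettyPrint := false) "LQ[" a ", " b ", " c ", " d "]" =>
  (!![(a : ℤ), -b, -c, -d; b, a, -d, c; c, d, a, -b; d, -c, b, a] : Matrix (Fin 4) (Fin 4) ℤ)

/-- `eB : Fin 4 × Fin 4 ≃ Fin 16`, `(r, m) ↦ 4m + r` (residue `r` inside block `m`). Local notation only. -/
local notation3 (prettyPrint := false) "eB" =>
  ((Equiv.prodComm (Fin 4) (Fin 4)).trans finProdFinEquiv : Fin 4 × Fin 4 ≃ Fin 16)

/-- `MC[a, b, c, d] ∈ M₁₆(ℤ)`: four diagonal copies of `LQ[a, b, c, d]` on the blocks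
`{4m, 4m+1, 4m+2, 4m+3}`. Local notation only. -/
local notation3 (prettyPrint := false) "MC[" a ", " b ", " c ", " d "]" =>
  (Matrix.submatrix (Matrix.blockDiagonal fun _ : Fin 4 => LQ[a, b, c, d])
    (Equiv.symm eB) (Equiv.symm eB) : Matrix (Fin 16) (Fin 16) ℤ)

/-! ## The quaternion block -/

/-- `eB (r, m) = 4m + r`. [folklore] -/
theorem eB_apply_val (r m : Fin 4) : (eB (r, m)).val = r.val + 4 * m.val := rfl

/-- **Euler's four-square identity**: `L_xᵀ L_x = N(x)·1` for the Lipschitz quaternion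
`x = a + bi + cj + dk`. [folklore] -/
theorem lipschitz_transpose_mul_self (a b c d : ℤ) :
    (LQ[a, b, c, d])ᵀ * LQ[a, b, c, d] =
      (a ^ 2 + b ^ 2 + c ^ 2 + d ^ 2) • (1 : Matrix (Fin 4) (Fin 4) ℤ) := by
  ext i j
  fin_cases i <;> fin_cases j <;>
    simp [Matrix.mul_apply, Fin.sum_univ_four, Matrix.transpose_apply] <;> ring

/-- `MCᵀ MC = N(x)·1` on `ℤ¹⁶` (blockwise Euler). [folklore] -/
theorem mc_transpose_mul_mc (a b c d : ℤ) :
    (MC[a, b, c, d])ᵀ * MC[a, b, c, d] =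
      (a ^ 2 + b ^ 2 + c ^ 2 + d ^ 2) • (1 : Matrix (Fin 16) (Fin 16) ℤ) := by
  rw [Matrix.transpose_submatrix, Matrix.submatrix_mul_equiv, Matrix.blockDiagonal_transpose,
    ← Matrix.blockDiagonal_mul]
  simp only [lipschitz_transpose_mul_self]
  rw [show (fun _ : Fin 4 => (a ^ 2 + b ^ 2 + c ^ 2 + d ^ 2) • (1 : Matrix (Fin 4) (Fin 4) ℤ)) =
      (a ^ 2 + b ^ 2 + c ^ 2 + d ^ 2) • (1 : Fin 4 → Matrix (Fin 4) (Fin 4) ℤ) from rfl,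
    Matrix.blockDiagonal_smul, Matrix.blockDiagonal_one, Matrix.submatrix_smul, Pi.smul_apply,
    Pi.smul_apply, Matrix.submatrix_one_equiv]

/-- Row `4m + r` of `MC y` is row `r` of `L` applied to the block `(y(4m), …, y(4m+3))`. [folklore] -/
theorem mc_mulVec_apply (a b c d : ℤ) (y : Fin 16 → ℤ) (r m : Fin 4) :
    (MC[a, b, c, d] *ᵥ y) (eB (r, m)) = ∑ j : Fin 4, LQ[a, b, c, d] r j * y (eB (j, m)) := by
  rw [Matrix.submatrix_mulVec_equiv]
  simp only [Function.comp_apply, Equiv.symm_symm, Equiv.symm_apply_apply, Matrix.mulVec,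
    dotProduct, Fintype.sum_prod_type, Matrix.blockDiagonal_apply']
  refine Finset.sum_congr rfl fun j _ => ?_
  simp only [ite_mul, zero_mul, Finset.sum_ite_eq, Finset.mem_univ, if_true]

/-! ## The code `RM(1,4)` in block coordinates -/

/-- The affine function `c₀ + Σ_k c_k Bit_k` at the index `4m + j`: `Bit₀, Bit₁` are the digits of
`j`, `Bit₂, Bit₃` those of `m`. [folklore] -/
theorem rm14_bits_block (γ : Fin 4 → ℤ) (j m : Fin 4) :
    ∑ k : Fin 4, γ k * Bit[k, eB (j, m)] =
      γ 0 * ((j.val % 2 : ℕ) : ℤ) + γ 1 * ((j.val / 2 % 2 : ℕ) : ℤ) +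
        γ 2 * ((m.val % 2 : ℕ) : ℤ) + γ 3 * ((m.val / 2 % 2 : ℕ) : ℤ) := by
  have hj := j.isLt
  have hm := m.isLt
  have h0 : ((eB (j, m)).val / 2 ^ (0 : Fin 4).val % 2 : ℕ) = j.val % 2 := by
    rw [eB_apply_val]; change (j.val + 4 * m.val) / 1 % 2 = _; omega
  have h1 : ((eB (j, m)).val / 2 ^ (1 : Fin 4).val % 2 : ℕ) = j.val / 2 % 2 := by
    rw [eB_apply_val]; change (j.val + 4 * m.val) / 2 % 2 = _; omega
  have h2 : ((eB (j, m)).val / 2 ^ (2 : Fin 4).val % 2 : ℕ) = m.val % 2 := by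
    rw [eB_apply_val]; change (j.val + 4 * m.val) / 4 % 2 = _; omega
  have h3 : ((eB (j, m)).val / 2 ^ (3 : Fin 4).val % 2 : ℕ) = m.val / 2 % 2 := by
    rw [eB_apply_val]; change (j.val + 4 * m.val) / 8 % 2 = _; omega
  rw [Fin.sum_univ_four, h0, h1, h2, h3]

/-- **Parity bookkeeping** (holds for all integers `a, b, c, d`): if `w : Fin 4 → ℤ` is affine mod 2 on
a block, `w j ≡ γ₀ + (γ 0) j₀ + (γ 1) j₁ + (γ 2) B₂ + (γ 3) B₃` with `j = j₀ + 2 j₁`, then every row `r`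
of `L_x w` is affine mod 2 in the digits of `r`, with coefficients `γ₀ ↦ S γ₀ + (b + d) (γ 0) +
(c + d) (γ 1)`, `γ k ↦ S (γ k)`, `S = a + b + c + d` (the rows of `L_x` are signed permutations of
`(a, b, c, d)`; mod 2, `L_i, L_j, L_k` are the three translations of the plane `𝔽₂²`). [folklore] -/
theorem parity_block (a b c d γ₀ B₂ B₃ : ℤ) (γ w : Fin 4 → ℤ)
    (h : ∀ j : Fin 4, (2 : ℤ) ∣ w j - γ₀ - (γ 0 * ((j.val % 2 : ℕ) : ℤ) +
      γ 1 * ((j.val / 2 % 2 : ℕ) : ℤ) + γ 2 * B₂ + γ 3 * B₃)) (r : Fin 4) :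
    (2 : ℤ) ∣ (∑ j : Fin 4, LQ[a, b, c, d] r j * w j) -
      ((a + b + c + d) * γ₀ + (b + d) * γ 0 + (c + d) * γ 1) -
      ((a + b + c + d) * γ 0 * ((r.val % 2 : ℕ) : ℤ) + (a + b + c + d) * γ 1 * ((r.val / 2 % 2 : ℕ) : ℤ) +
        (a + b + c + d) * γ 2 * B₂ + (a + b + c + d) * γ 3 * B₃) := by
  obtain ⟨z0, hz0⟩ := h 0
  obtain ⟨z1, hz1⟩ := h 1
  obtain ⟨z2, hz2⟩ := h 2
  obtain ⟨z3, hz3⟩ := h 3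
  simp only [Fin.coe_ofNat_eq_mod, Nat.reduceMod, Nat.reduceDiv, Nat.zero_div,
    Nat.zero_mod, Nat.cast_zero, Nat.cast_one, mul_zero, mul_one, add_zero,
    zero_add] at hz0 hz1 hz2 hz3
  have hw0 : w 0 = γ₀ + γ 2 * B₂ + γ 3 * B₃ + 2 * z0 := by omega
  have hw1 : w 1 = γ₀ + γ 0 + γ 2 * B₂ + γ 3 * B₃ + 2 * z1 := by omega
  have hw2 : w 2 = γ₀ + γ 1 + γ 2 * B₂ + γ 3 * B₃ + 2 * z2 := by omega
  have hw3 : w 3 = γ₀ + γ 0 + γ 1 + γ 2 * B₂ + γ 3 * B₃ + 2 * z3 := by omega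
  fin_cases r <;> simp [Fin.sum_univ_four, hw0, hw1, hw2, hw3] <;> ring_nf <;> omega

/-- `MC` preserves `RM(1,4)` mod 2, with explicit new coefficients. [folklore] -/
theorem mc_mulVec_affineMod2 (a b c d : ℤ) (y : Fin 16 → ℤ) (hy : AffineMod2[y]) :
    AffineMod2[MC[a, b, c, d] *ᵥ y] := by
  obtain ⟨γ₀, γ, h⟩ := hy
  refine ⟨(a + b + c + d) * γ₀ + (b + d) * γ 0 + (c + d) * γ 1, fun k => (a + b + c + d) * γ k,
    fun s => ?_⟩
  obtain ⟨⟨r, m⟩, rfl⟩ := (eB).surjective s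
  rw [mc_mulVec_apply, rm14_bits_block]
  exact parity_block a b c d γ₀ _ _ γ (fun j => y (eB (j, m)))
    (fun j => by simpa only [rm14_bits_block] using h (eB (j, m))) r

/-! ## The stub -/

/-- **Stub 1 — `stub_kummerCode` (the card's First lemma `KummerCodeSimilitude`).**
For every prime `q` there is `Mc ∈ M₁₆(ℤ)` with `Mcᵀ Mc = q·1` whose reduction mod 2 maps affine functions
on `𝔽₂⁴` (= `Fin 16` read in binary, `Bit`) to affine functions, i.e. preserves `RM(1,4)`:
`q = a²+b²+c²+d²` (`Nat.sum_four_squares`) and `Mc = diag(L_x, L_x, L_x, L_x)`, `L_x` = left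
multiplication by the Lipschitz quaternion `x = a+bi+cj+dk` on the blocks `{4m, …, 4m+3}`. [folklore] -/
theorem stub_kummerCode :
    ∀ q : ℕ, q.Prime → ∃ Mc : Matrix (Fin 16) (Fin 16) ℤ, CodeMatrix[q, Mc] := by
  intro q _
  obtain ⟨a, b, c, d, habcd⟩ := Nat.sum_four_squares q
  refine ⟨MC[(a : ℤ), (b : ℤ), (c : ℤ), (d : ℤ)], ?_, fun y hy => mc_mulVec_affineMod2 _ _ _ _ y hy⟩
  rw [mc_transpose_mul_mc]
  congr 1
  exact_mod_cast habcd

end Summit.HodgeConjecture.HodgeConjecture.Theorems.NikulinTwinTransport.KummerBkrQuaternionCarrier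

end
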